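import Summits.ResolutionOfSingularities.ResolutionOfSingularities.Cruxes.DescentPerfectToAll.Disproof
import Summits.ResolutionOfSingularities.ResolutionOfSingularities.Theorems.DescentDescentPerfectToAllRobustModel
import Summits.ResolutionOfSingularities.ResolutionOfSingularities.Theorems.DescentDescentPerfectToAllFgModel
import Summits.ResolutionOfSingularities.ResolutionOfSingularities.Theorems.DescentDescentPerfectToAllResidualWitnessCountable

/-!
# `DescentPerfectToAll` (stmt-ResolutionOfSingularities-0549) — lens 6, gen 2: SUPPORT SKELETON `negation-limit-descent`

Planner workfile (unit `res-B-lens-6-g2`, LADDER-RESOLUTION rung B, D-0159; card `Lines/negation-limit-descent.md`).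
Resolution of singularities in characteristic `p` is NOT proved anywhere in this file or this tree; nothing here is
«progress on resolution»; rung B (`DescentPerfectToAll`) stays OPEN.

## What this skeleton is (and is not)
`NegationLens6.lean` (gen 1, critic ACCEPTED as bookkeeping, evidence #55/#56) certified the negative normal form of rung B —
`KeyH p ↔ ¬ ResolutionInChar p`, `¬ crux ↔ ∃ p, PerfectRes p ∧ KeyH p`, the residual normal form — MODULO the one named,
standard, not-yet-landed input `NegationLens6.ResolutionDescendsToLevel` (EGA IV₃ 8.8.2 (ii) + 8.10.5 (i),(xii): a resolution of
`X₀ ×_{K₀} k` comes, after enlarging the finitely generated coefficient field, from a proper birational model whose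
coefficient extension is the given regular source).  The critic's provisional verdict asked to «land `ResolutionDescendsToLevel`
… so §2–§4 become unconditional tree theorems».  THIS FILE is the checked plan for that: it cuts `ResolutionDescendsToLevel`
into TWO genuine limit-formalism lemmas over existing declarations and KERNEL-CHECKS the composition.

* `ProperSpreadsToLevel` (STUB S1, EGA IV₃ 8.8.2 (ii) + 8.10.5 (xii); Görtz–Wedhorn I Thm. 10.63/10.66, Prop. 10.75): a PROPER
  `ρ : Z → X₀ ×_{K₀} k` is, for some finitely generated level `L ⊇ K₀`, the coefficient extension `Y ×_L k` of a PROPER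
  `π : Y → X₀ ×_{K₀} L`, compatibly with the canonical comparison map `ψ : Y ×_L k → X₀ ×_{K₀} k`.
* `BirationalDescendsToLevel` (STUB S2, EGA IV₃ 8.3.11 descent of quasi-compact opens + fpqc descent of isomorphisms
  (8.10.5 (i) / Mathlib `DescendsAlong`) + density under the surjection `X₀ ×_{K₀} k → X₀ ×_{K₀} L'`): if that comparison map
  `ψ` is BIRATIONAL then, after enlarging the level, `π' : Y' → X₀ ×_{K₀} L'` is proper AND birational with the same top
  `Y' ×_{L'} k ≅ Y ×_L k`.
* `resolutionDescendsToLevel_of : S1 → S2 → ResolutionDescendsToLevel` — PROVED (no sorry): regularity of the top is transported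
  from the resolution source `Z` along `Z ≅ Y ×_L k ≅ Y' ×_{L'} k` (`Scheme.IsRegular.of_iso`), birationality of `ψ = e⁻¹ ≫ ρ`
  from that of `ρ`.
* §3: with the two stubs in place, gen 1's conditional theorems become unconditional BY NAME (`keyH_iff_not_resolutionInChar`,
  `not_crux_iff_perfectRes_and_keyH`, `not_crux_iff_residual`, `keyH_refutes_cruxAt_iff`).
* §4 (rev 2, PROVED, no stub): gen 1's `ExistsResidualFieldOfPRankOne p` («exists on paper» in gen 1 §4) is a KERNEL fact for every
  prime `p` — `existsResidualFieldOfPRankOne` — from the landed `Theorems.exists_countable_digitClosed_subfield_laurentSeries` and the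
  non-exhaustion argument of `Theorems.exists_countable_field_not_exhaustedByEssFiniteType` (countable digit-closed subfield of `𝔽_p((X))`;
  `X ∉ k^p` by `HahnSeries.order_pow`).

IMPORTS.  `Cruxes/…` workfiles are not library build targets; gen 1's `NegationLens6.lean` (commit 9ec37c099881) is not yet in
the farm's build snapshot, so this file imports exactly what gen 1 imports (`Disproof` + the landed `Theorems.stub_fgModel`,
`Theorems.stub_resolutionOfRobustModel`) and carries VERBATIM COPIES of gen 1's five §1 definitions (`RobustAtLevel`,
`NoRobustLevel`, `AllModelsWound`, `KeyH`, `ResolutionDescendsToLevel`) — same text, so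
`NegationLimitDescent.X = NegationLens6.X` holds by `rfl` (bridge file `Lines/negation_limit_descent_bridge.lean`, to be checked
once both modules are in one snapshot) — and re-derives the four §2/§3 consequences it needs in ≤ 10 lines each.

`lean check` (rev 2): rc 0, the ONLY `sorry`s are the two `stub_*`; §4 is sorry-free.  This skeleton does NOT conclude the crux `DescentPerfectToAll` (it cannot:
its content is the NEGATIVE bookkeeping of rung B), so it is not registered with `skeleton check --crux`; it is a seatable SUPPORT
task: prove S1 and S2 verbatim under `Theorems/` (`--supports stmt-ResolutionOfSingularities-0549`), then replace the two `sorry`s by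
the theorem names.  Nearest landed tools: `Theorems.stub_descendResolutionData` (S1 for ALGEBRAIC towers, intermediate-field
stages — here the tower is over the finitely generated SUBFIELDS of an arbitrary extension `k ⊇ K₀`), `Theorems.stub_fgModel` /
`Theorems.stub_levelResolution` (the `SubalgApprox` subalgebra-stage limit presentation of `X₀ ×_{K₀} k`),
`Literature.AlgebraicGeometry.Limits.exists_isPullback_toImage_of_isLocallyNoetherian`, `…LocalizationOpenDescent`,
`…Resolution.FiniteSubextensionDescent.descends_of_isPullback`, `…AlterationsDescentStage.isProper_of_isPullback`,
`Theorems.isBirational_of_isPullback_of_flat` (the converse direction of S2, landed).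
-/

noncomputable section

set_option linter.dupNamespace false

open AlgebraicGeometry CategoryTheory CategoryTheory.Limits
open Literature.AlgebraicGeometry.Resolution
open scoped LaurentSeries

namespace Summit.ResolutionOfSingularities.ResolutionOfSingularities.Cruxes.DescentPerfectToAll.NegationLimitDescent

/-! ## §0 Gen 1's definitions, VERBATIM (see IMPORTS above; bridge = `rfl`) -/

/-- VERBATIM COPY of `NegationLens6.RobustAtLevel`: the model `f₀ : X₀ → Spec K₀` is ROBUST AT THE LEVEL `L ⊇ K₀` (subfields of
`k`): the level `X₀ ×_{K₀} L` has a proper birational `π : Y → X₀ ×_{K₀} L` whose coefficient extension `Y ×_L k` is regular. -/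
def RobustAtLevel {k : Type} [Field k] {K₀ : Subfield k} {X₀ : Scheme.{0}} (f₀ : X₀ ⟶ Spec (.of K₀))
    (L : Subfield k) (hL : K₀ ≤ L) : Prop :=
  ∃ (Y : Scheme.{0}) (π : Y ⟶ pullback f₀ (Spec.map (CommRingCat.ofHom (Subfield.inclusion hL)))),
    IsProper π ∧ IsBirational π ∧
      Scheme.IsRegular (pullback (π ≫ pullback.snd f₀ (Spec.map (CommRingCat.ofHom (Subfield.inclusion hL))))
        (Spec.map (CommRingCat.ofHom L.subtype)))

/-- VERBATIM COPY of `NegationLens6.NoRobustLevel` («Q1∞»: no finitely generated level of the model is robust). -/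
def NoRobustLevel {k : Type} [Field k] {K₀ : Subfield k} {X₀ : Scheme.{0}} (f₀ : X₀ ⟶ Spec (.of K₀)) :
    Prop :=
  ∀ (L : Subfield k) (hL : K₀ ≤ L) (t : Finset k), L = Subfield.closure (↑t : Set k) → ¬ RobustAtLevel f₀ L hL

/-- VERBATIM COPY of `NegationLens6.AllModelsWound` (every f.g. model of `X/k` has no robust f.g. level). -/
def AllModelsWound (k : Type) [Field k] (X : Scheme.{0}) : Prop :=
  ∀ (K₀ : Subfield k) (s : Finset k), K₀ = Subfield.closure (↑s : Set k) →
    ∀ (X₀ : Scheme.{0}) (f₀ : X₀ ⟶ Spec (.of K₀)), IsSeparated f₀ → LocallyOfFiniteType f₀ →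
      QuasiCompact f₀ → Nonempty (X ≅ pullback f₀ (Spec.map (CommRingCat.ofHom K₀.subtype))) →
        NoRobustLevel f₀

/-- VERBATIM COPY of `NegationLens6.KeyH` (the KEY's hypothesis at the prime `p`). -/
def KeyH (p : ℕ) : Prop :=
  ∃ (k : Type) (_ : Field k) (_ : CharP k p) (X : Scheme.{0}) (f : X ⟶ Spec (.of k)),
    IsSeparated f ∧ LocallyOfFiniteType f ∧ QuasiCompact f ∧ IsReduced X ∧ AllModelsWound k X

/-- VERBATIM COPY of `NegationLens6.ResolutionDescendsToLevel` — the statement this skeleton decomposes: a resolution of the top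
`X₀ ×_{K₀} k` of a f.g. model yields a robust finitely generated level.
[cite: EGAIV3, Thm. 8.8.2 (ii), Thm. 8.10.5 (i), (xii)] -/
def ResolutionDescendsToLevel : Prop :=
  ∀ (k : Type) [Field k] (K₀ : Subfield k) (s : Finset k), K₀ = Subfield.closure (↑s : Set k) →
    ∀ (X₀ : Scheme.{0}) (f₀ : X₀ ⟶ Spec (.of K₀)), IsSeparated f₀ → LocallyOfFiniteType f₀ →
      QuasiCompact f₀ → Scheme.HasResolution (pullback f₀ (Spec.map (CommRingCat.ofHom K₀.subtype))) →
        ∃ (L : Subfield k) (hL : K₀ ≤ L) (t : Finset k), L = Subfield.closure (↑t : Set k) ∧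
          RobustAtLevel f₀ L hL

/-! ## §1 The two stub statements (fully expanded over Mathlib / Literature declarations) -/

/-- **S1 — a proper scheme over the top spreads to a proper scheme over a finitely generated level.**  For `K₀ = closure s ⊆ k`
finitely generated, `f₀ : X₀ → Spec K₀` separated quasi-compact locally of finite type, and a PROPER `ρ : Z → X₀ ×_{K₀} k`, there
are a finitely generated level `L = closure t ⊇ K₀`, a PROPER `π : Y → X₀ ×_{K₀} L`, the canonical comparison map
`ψ : Y ×_L k → X₀ ×_{K₀} k` (characterised by its two projections) and an isomorphism `e : Z ≅ Y ×_L k` with `e ≫ ψ = ρ`.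
(`X₀ ×_{K₀} k = lim_L X₀ ×_{K₀} L` over the finitely generated subfields `L ⊇ K₀` of `k`, affine flat transition maps; `ρ` is of
finite presentation since the top is Noetherian.) [cite: EGAIV3, Thm. 8.8.2 (ii), Thm. 8.10.5 (xii); GortzWedhorn2020, Thm. 10.63, Thm. 10.66, Prop. 10.75] -/
def ProperSpreadsToLevel : Prop :=
  ∀ (k : Type) [Field k] (K₀ : Subfield k) (s : Finset k), K₀ = Subfield.closure (↑s : Set k) →
    ∀ (X₀ : Scheme.{0}) (f₀ : X₀ ⟶ Spec (.of K₀)), IsSeparated f₀ → LocallyOfFiniteType f₀ → QuasiCompact f₀ →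
      ∀ (Z : Scheme.{0}) (ρ : Z ⟶ pullback f₀ (Spec.map (CommRingCat.ofHom K₀.subtype))), IsProper ρ →
        ∃ (L : Subfield k) (hL : K₀ ≤ L) (t : Finset k), L = Subfield.closure (↑t : Set k) ∧
          ∃ (Y : Scheme.{0}) (π : Y ⟶ pullback f₀ (Spec.map (CommRingCat.ofHom (Subfield.inclusion hL))))
            (ψ : pullback (π ≫ pullback.snd f₀ (Spec.map (CommRingCat.ofHom (Subfield.inclusion hL))))
                (Spec.map (CommRingCat.ofHom L.subtype)) ⟶ pullback f₀ (Spec.map (CommRingCat.ofHom K₀.subtype)))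
            (e : Z ≅ pullback (π ≫ pullback.snd f₀ (Spec.map (CommRingCat.ofHom (Subfield.inclusion hL))))
                (Spec.map (CommRingCat.ofHom L.subtype))),
            IsProper π ∧
              ψ ≫ pullback.fst f₀ (Spec.map (CommRingCat.ofHom K₀.subtype)) =
                pullback.fst (π ≫ pullback.snd f₀ (Spec.map (CommRingCat.ofHom (Subfield.inclusion hL))))
                    (Spec.map (CommRingCat.ofHom L.subtype)) ≫ π ≫
                  pullback.fst f₀ (Spec.map (CommRingCat.ofHom (Subfield.inclusion hL))) ∧
              ψ ≫ pullback.snd f₀ (Spec.map (CommRingCat.ofHom K₀.subtype)) =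
                pullback.snd (π ≫ pullback.snd f₀ (Spec.map (CommRingCat.ofHom (Subfield.inclusion hL))))
                  (Spec.map (CommRingCat.ofHom L.subtype)) ∧
              e.hom ≫ ψ = ρ

/-- **S2 — birationality of the coefficient extension descends to a finitely generated level.**  For `f₀ : X₀ → Spec K₀` separated
quasi-compact locally of finite type, a finitely generated level `L = closure t ⊇ K₀`, a PROPER `π : Y → X₀ ×_{K₀} L` and the
canonical comparison map `ψ : Y ×_L k → X₀ ×_{K₀} k` (its two projections prescribed; it is the base change of `π`): if `ψ` is
BIRATIONAL then for some finitely generated level `L' = closure t' ⊇ K₀` there is a proper BIRATIONAL `π' : Y' → X₀ ×_{K₀} L'`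
with the same top, `Y' ×_{L'} k ≅ Y ×_L k`.  (Take `L' = L(t₁)` where the dense quasi-compact open `U` of isomorphy of `ψ`
descends, `Y' = Y ×_L L'`, `π' = π ×_L L'`: `π'` is an isomorphism over `U_{L'}` by fpqc descent of isomorphisms along the flat
surjective affine `X₀ ×_{K₀} k → X₀ ×_{K₀} L'`, and `U_{L'}`, `π'⁻¹ U_{L'}` are dense because their preimages under the
SURJECTIVE maps from the top are the dense `U`, `ψ⁻¹ U`.) [cite: EGAIV3, Thm. 8.3.11, Thm. 8.10.5 (i); EGAIV2, Prop. 2.4.10; GortzWedhorn2020, Thm. 10.57, Prop. 14.53] -/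
def BirationalDescendsToLevel : Prop :=
  ∀ (k : Type) [Field k] (K₀ : Subfield k) (X₀ : Scheme.{0}) (f₀ : X₀ ⟶ Spec (.of K₀)),
    IsSeparated f₀ → LocallyOfFiniteType f₀ → QuasiCompact f₀ →
      ∀ (L : Subfield k) (hL : K₀ ≤ L) (t : Finset k), L = Subfield.closure (↑t : Set k) →
        ∀ (Y : Scheme.{0}) (π : Y ⟶ pullback f₀ (Spec.map (CommRingCat.ofHom (Subfield.inclusion hL))))
          (ψ : pullback (π ≫ pullback.snd f₀ (Spec.map (CommRingCat.ofHom (Subfield.inclusion hL))))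
              (Spec.map (CommRingCat.ofHom L.subtype)) ⟶ pullback f₀ (Spec.map (CommRingCat.ofHom K₀.subtype))),
          IsProper π →
            ψ ≫ pullback.fst f₀ (Spec.map (CommRingCat.ofHom K₀.subtype)) =
              pullback.fst (π ≫ pullback.snd f₀ (Spec.map (CommRingCat.ofHom (Subfield.inclusion hL))))
                  (Spec.map (CommRingCat.ofHom L.subtype)) ≫ π ≫
                pullback.fst f₀ (Spec.map (CommRingCat.ofHom (Subfield.inclusion hL))) →
            ψ ≫ pullback.snd f₀ (Spec.map (CommRingCat.ofHom K₀.subtype)) =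
              pullback.snd (π ≫ pullback.snd f₀ (Spec.map (CommRingCat.ofHom (Subfield.inclusion hL))))
                (Spec.map (CommRingCat.ofHom L.subtype)) →
            IsBirational ψ →
              ∃ (L' : Subfield k) (hL' : K₀ ≤ L') (t' : Finset k), L' = Subfield.closure (↑t' : Set k) ∧
                ∃ (Y' : Scheme.{0}) (π' : Y' ⟶ pullback f₀ (Spec.map (CommRingCat.ofHom (Subfield.inclusion hL')))),
                  IsProper π' ∧ IsBirational π' ∧
                    Nonempty
                      (pullback (π' ≫ pullback.snd f₀ (Spec.map (CommRingCat.ofHom (Subfield.inclusion hL'))))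
                          (Spec.map (CommRingCat.ofHom L'.subtype)) ≅
                        pullback (π ≫ pullback.snd f₀ (Spec.map (CommRingCat.ofHom (Subfield.inclusion hL))))
                          (Spec.map (CommRingCat.ofHom L.subtype)))

/-! ## §2 The stubs and the kernel-checked composition -/

/-- STUB S1 (to be proved under `Theorems/`, statement = `ProperSpreadsToLevel` unfolded; size L: the subfield-stage limit
presentation + absolute Noetherian approximation of the proper `Z` + descent of properness).
[cite: EGAIV3, Thm. 8.8.2 (ii), Thm. 8.10.5 (xii); GortzWedhorn2020, Thm. 10.63, Thm. 10.66, Prop. 10.75] -/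
theorem stub_properSpreadsToLevel : ProperSpreadsToLevel := by
  sorry

/-- STUB S2 (to be proved under `Theorems/`, statement = `BirationalDescendsToLevel` unfolded; size M: descent of one quasi-compact
open + fpqc descent of `IsIso` + two density transfers along surjections).
[cite: EGAIV3, Thm. 8.3.11, Thm. 8.10.5 (i); GortzWedhorn2020, Thm. 10.57, Prop. 14.53] -/
theorem stub_birationalDescendsToLevel : BirationalDescendsToLevel := by
  sorry

/-- An isomorphism is birational (restated to keep imports minimal; cf. `isBirational_of_isIso` of
`SandwichedWeakPatching.lean`). [folklore] -/
theorem isBirational_of_isIso {X Y : Scheme.{0}} (e : X ⟶ Y) [IsIso e] : IsBirational e :=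
  ⟨⊤, by simp, by simp, inferInstance⟩

/-- **COMPOSITION (kernel-checked, no sorry): `S1 → S2 → ResolutionDescendsToLevel`.**  Given a resolution `ρ : Z → X₀ ×_{K₀} k`:
S1 spreads the proper `ρ` to a proper `π : Y → X₀ ×_{K₀} L` with `Z ≅ Y ×_L k` over the comparison map `ψ`; `ψ = e⁻¹ ≫ ρ` is
birational; S2 enlarges the level to make `π'` proper birational with the same top; the top `Y' ×_{L'} k ≅ Y ×_L k ≅ Z` is regular
because `Z` is.  That is `RobustAtLevel f₀ L' hL'`. [cite: EGAIV3, Thm. 8.8.2 (ii), Thm. 8.10.5 (i), (xii)] -/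
theorem resolutionDescendsToLevel_of (h₁ : ProperSpreadsToLevel) (h₂ : BirationalDescendsToLevel) :
    ResolutionDescendsToLevel := by
  intro k _ K₀ s hK₀ X₀ f₀ hs hl hq hres
  obtain ⟨Z, ρ, hprop, hbir, hreg⟩ := hres
  obtain ⟨L, hL, t, hLt, Y, π, ψ, e, hπ, hψ₁, hψ₂, hcomp⟩ := h₁ k K₀ s hK₀ X₀ f₀ hs hl hq Z ρ hprop
  have hψ : IsBirational ψ := by
    have hψe : ψ = e.inv ≫ ρ := by rw [← hcomp, Iso.inv_hom_id_assoc]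
    rw [hψe]
    exact ComponentGluing.IsBirational.comp (isBirational_of_isIso e.inv) hbir
  obtain ⟨L', hL', t', hLt', Y', π', hπ', hbir', ⟨e'⟩⟩ :=
    h₂ k K₀ X₀ f₀ hs hl hq L hL t hLt Y π ψ hπ hψ₁ hψ₂ hψ
  refine ⟨L', hL', t', hLt', Y', π', hπ', hbir', ?_⟩
  exact Scheme.IsRegular.of_iso e'.inv (Scheme.IsRegular.of_iso e.hom hreg)

/-- `ResolutionDescendsToLevel` from the two DECLARED STUBS by name (sorried until S1, S2 land under `Theorems/`). [folklore] -/
theorem resolutionDescendsToLevel_proof : ResolutionDescendsToLevel :=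
  resolutionDescendsToLevel_of stub_properSpreadsToLevel stub_birationalDescendsToLevel

/-! ## §3 What becomes unconditional once S1 and S2 land (gen 1's §2–§3, re-derived from the stubs) -/

/-- A robust level resolves the top (the landed `Theorems.stub_resolutionOfRobustModel`; = gen 1's
`hasResolution_of_robustAtLevel`). [folklore] -/
theorem hasResolution_of_robustAtLevel {k : Type} [Field k] {K₀ : Subfield k} {X₀ : Scheme.{0}}
    (f₀ : X₀ ⟶ Spec (.of K₀)) (hs : IsSeparated f₀) (hl : LocallyOfFiniteType f₀) (hq : QuasiCompact f₀)
    {L : Subfield k} {hL : K₀ ≤ L} (h : RobustAtLevel f₀ L hL) :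
    Scheme.HasResolution (pullback f₀ (Spec.map (CommRingCat.ofHom K₀.subtype))) := by
  obtain ⟨Y, π, hp, hb, hr⟩ := h
  exact Theorems.stub_resolutionOfRobustModel k K₀ L hL X₀ f₀ hs hl hq Y π hp hb hr

/-- UNCONDITIONAL (= gen 1): a scheme without resolution has all its f.g. models wounded at every f.g. level. [folklore] -/
theorem allModelsWound_of_not_hasResolution {k : Type} [Field k] {X : Scheme.{0}}
    (hX : ¬ Scheme.HasResolution X) : AllModelsWound k X := by
  intro K₀ s _ X₀ f₀ hs hl hq e L hL t _ hrob
  obtain ⟨e⟩ := e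
  exact hX ((hasResolution_of_robustAtLevel f₀ hs hl hq hrob).of_iso e.inv)

/-- FROM THE STUBS (gen 1 had `hlim` here): `AllModelsWound k X` for a reduced separated f.t. `X/k` forces `¬ HasResolution X`
(`Theorems.stub_fgModel` gives a f.g. model; `resolutionDescendsToLevel_proof` gives a robust level of it). [folklore] -/
theorem not_hasResolution_of_allModelsWound {k : Type} [Field k] {X : Scheme.{0}} (f : X ⟶ Spec (.of k))
    (hs : IsSeparated f) (hl : LocallyOfFiniteType f) (hq : QuasiCompact f) (hr : IsReduced X)
    (h : AllModelsWound k X) : ¬ Scheme.HasResolution X := by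
  intro hX
  obtain ⟨K₀, s, hK₀, X₀, f₀, h₁, h₂, h₃, -, ⟨e⟩⟩ := Theorems.stub_fgModel k X f hs hl hq hr
  obtain ⟨L, hL, t, hLt, hrob⟩ :=
    resolutionDescendsToLevel_proof k K₀ s hK₀ X₀ f₀ h₁ h₂ h₃ (hX.of_iso e.hom)
  exact h K₀ s hK₀ X₀ f₀ h₁ h₂ h₃ ⟨e⟩ L hL t hLt hrob

/-- FROM THE STUBS: `KeyH p ↔ ¬ ResolutionInChar p` — the KEY's geometric obstruction («every f.g.-model resolution
re-singularises») IS a counterexample to resolution in characteristic `p`, with no use of `PerfectRes`. [folklore] -/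
theorem keyH_iff_not_resolutionInChar {p : ℕ} : KeyH p ↔ ¬ ResolutionInChar.{0} p := by
  constructor
  · rintro ⟨k, _, _, X, f, hs, hl, hq, hr, hw⟩ hR
    exact not_hasResolution_of_allModelsWound f hs hl hq hr hw (hR k X f hs hl hq hr)
  · intro h
    unfold ResolutionInChar at h
    push Not at h
    obtain ⟨k, _, _, X, f, hs, hl, hq, hr, hX⟩ := h
    exact ⟨k, ‹_›, ‹_›, X, f, hs, hl, hq, hr, allModelsWound_of_not_hasResolution hX⟩

/-- FROM THE STUBS: NEGATIVE NORMAL FORM OF RUNG B, `¬ DescentPerfectToAll ↔ ∃ p prime, PerfectRes p ∧ KeyH p` — the KEY's `H`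
enters `¬B` only TOGETHER WITH a proof of resolution over all perfect fields of characteristic `p`. [folklore] -/
theorem not_crux_iff_perfectRes_and_keyH :
    ¬ Disproof.Crux ↔ ∃ p : ℕ, p.Prime ∧ Disproof.PerfectRes p ∧ KeyH p := by
  rw [Disproof.not_crux_iff]
  exact exists_congr fun p => and_congr_right fun _ => and_congr_right fun _ =>
    keyH_iff_not_resolutionInChar.symm

/-- FROM THE STUBS: an implication `KeyH p → ¬ (PerfectRes p → ResolutionInChar p)` is EXACTLY an implication
`KeyH p → PerfectRes p` — no obstruction short of `PerfectRes` separates rung B from R0. [folklore] -/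
theorem keyH_refutes_cruxAt_iff {p : ℕ} :
    (KeyH p → ¬ (Disproof.PerfectRes p → ResolutionInChar.{0} p)) ↔ (KeyH p → Disproof.PerfectRes p) := by
  refine ⟨fun h hH => ?_, fun h hH hC => keyH_iff_not_resolutionInChar.mp hH (hC (h hH))⟩
  by_contra hP
  exact h hH (fun hP' => absurd hP' hP)

/-- The item's statement is untouched: this file proves NOTHING about `DescentPerfectToAll` itself (the crux decl is only
MENTIONED, never concluded; `Disproof.Crux` is it by `Iff.rfl`). [folklore] -/
theorem crux_iff : Disproof.Crux ↔ Summit.ResolutionOfSingularities.ResolutionOfSingularities.Theses.Descent.DescentPerfectToAll :=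
  Iff.rfl

/-! ## §4 (rev 2) Gen 1's residual field of `p`-rank one EXISTS — kernel corollary of landed theorems

Gen 1 (`NegationLens6.lean` §4) introduced `ExistsResidualFieldOfPRankOne p` with the remark «which exist on paper».  The two
definitions below are VERBATIM copies of gen 1's; the theorem is sorry-free. Consequence for the LADDER wording of `¬B`: the
residual class (countable, not EFT-separably exhausted) contains fields of `p`-rank ONE — finite-`p`-rank hypotheses of
Cossart–Piltant type do not exclude it — as well as Mac Lane's field of infinite `p`-rank
(`Theorems.exists_countable_field_infinite_pRank_not_exhaustedByEssFiniteType`). -/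

/-- Verbatim copy of `NegationLens6.EFTSeparablyExhausted` (gen 1, §4). [folklore] -/
def EFTSeparablyExhausted (p : ℕ) (k : Type) [Field k] : Prop :=
  ∀ s : Finset k, ∃ (k₀ : Type) (_ : Field k₀) (_ : PerfectField k₀) (E : Subfield k)
    (_ : Algebra k₀ E), Algebra.EssFiniteType k₀ E ∧ (↑s : Set k) ⊆ E ∧
      ∀ u : Finset k, LinearIndepOn E _root_.id (↑u : Set k) →
        LinearIndepOn E (fun x : k => x ^ p) (↑u : Set k)

/-- Verbatim copy of `NegationLens6.ExistsResidualFieldOfPRankOne` (gen 1, §4). [folklore] -/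
def ExistsResidualFieldOfPRankOne (p : ℕ) : Prop :=
  ∃ (k : Type) (_ : Field k) (_ : CharP k p), Countable k ∧
    (∃ t : k, (∀ c : k, c ^ p ≠ t) ∧ ∀ x : k, ∃ c : Fin p → k, x = ∑ j : Fin p, t ^ (j : ℕ) * c j ^ p) ∧
      ¬ EFTSeparablyExhausted p k

/-- **Gen 1 §4 is a kernel fact, not «on paper»**: for every prime `p` there is a COUNTABLE field of
characteristic `p` of `p`-rank exactly one (`X` is a `p`-basis: `X ∉ k^p` and every element is
`∑_{j<p} X^j c_j^p`) that is NOT EFT-separably exhausted — the countable digit-closed subfield of `𝔽_p((X))`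
through an algebraically independent pair (`Theorems.exists_countable_digitClosed_subfield_laurentSeries`),
with the non-exhaustion argument of `Theorems.exists_countable_field_not_exhaustedByEssFiniteType` rerun on it.
[cite: Matsumura1987, Thm. 26.4 and Thm. 26.5; MacLane1939SteinitzTowers, §8] -/
theorem existsResidualFieldOfPRankOne (p : ℕ) [Fact p.Prime] : ExistsResidualFieldOfPRankOne p := by
  classical
  haveI : CharP ((ZMod p)⸨X⸩) p :=
    charP_of_injective_algebraMap (algebraMap (ZMod p) ((ZMod p)⸨X⸩)).injective p
  obtain ⟨u₁, u₂, hind⟩ := Theorems.exists_algebraicIndependent_pair_laurentSeries p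
  obtain ⟨K₀, hK₀c, hsub, hX, hdig⟩ := Theorems.exists_countable_digitClosed_subfield_laurentSeries p {u₁, u₂}
  haveI : CharP K₀ p := K₀.subtype.charP Subtype.val_injective p
  letI : Algebra (ZMod p) K₀ := (ZMod.castHom (dvd_refl p) K₀).toAlgebra
  have hu₁ : u₁ ∈ K₀ := hsub (by simp)
  have hu₂ : u₂ ∈ K₀ := hsub (by simp)
  have hcomp : K₀.subtype.comp (algebraMap (ZMod p) K₀) = algebraMap (ZMod p) ((ZMod p)⸨X⸩) :=
    Subsingleton.elim _ _
  refine ⟨K₀, inferInstance, inferInstance, hK₀c,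
    ⟨⟨HahnSeries.single (1 : ℤ) (1 : ZMod p), hX⟩, ?_, ?_⟩, ?_⟩
  · -- `X` is not a `p`-th power: orders (`p • ord c = 1` is impossible)
    intro c hc
    have hc' : (c : (ZMod p)⸨X⸩) ^ p = HahnSeries.single (1 : ℤ) (1 : ZMod p) := by
      have h := congrArg Subtype.val hc
      simpa using h
    have hord := congrArg HahnSeries.order hc'
    rw [HahnSeries.order_pow, HahnSeries.order_single one_ne_zero, nsmul_eq_mul] at hord
    have hdvd : (p : ℤ) ∣ 1 := ⟨(c : (ZMod p)⸨X⸩).order, hord.symm⟩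
    have h1 : (p : ℤ) = 1 := Int.eq_one_of_dvd_one (Int.natCast_nonneg p) hdvd
    exact (Fact.out : p.Prime).one_lt.ne' (by exact_mod_cast h1)
  · -- every element is `∑_{j<p} X^j c_j^p` with digits in `K₀`
    intro x
    obtain ⟨r, hrK, hx⟩ := hdig x x.2
    refine ⟨fun j => ⟨r j, hrK j⟩, Subtype.ext ?_⟩
    push_cast
    exact hx
  · -- not EFT-separably exhausted (the argument of `exists_countable_field_not_exhaustedByEssFiniteType`)
    set xK : Option (Fin 1) → K₀ := fun o => o.elim ⟨u₂, hu₂⟩ ![⟨u₁, hu₁⟩] with hxK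
    have hxKval : (fun o => K₀.subtype (xK o)) = fun o : Option (Fin 1) => o.elim u₂ ![u₁] := by
      funext o
      rcases o with _ | i
      · rfl
      · simp only [hxK, Option.elim_some, Matrix.cons_val_fin_one]
        rfl
    have hφ0 : ∀ a : ZMod p, ∃ c : ZMod p,
        K₀.subtype (algebraMap (ZMod p) K₀ a) = algebraMap (ZMod p) ((ZMod p)⸨X⸩) c :=
      fun a => ⟨a, by rw [← RingHom.comp_apply, hcomp]⟩
    have hindK : AlgebraicIndependent (ZMod p) xK :=
      Theorems.algebraicIndependent_of_ringHom_eq p K₀.subtype hφ0 xK (hxKval ▸ hind)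
    unfold EFTSeparablyExhausted
    refine Theorems.not_exhaustedByEssFiniteType_of_pRank_le_one p K₀ ?_ ?_ xK hindK (by simp)
    · -- (a) `[K₀ : K₀^p] ≤ p`
      intro n v hv
      refine Theorems.card_le_of_linearIndependent_of_span_eq_top
        (fun e : Fin p => (⟨HahnSeries.single (1 : ℤ) (1 : ZMod p), hX⟩ : K₀) ^ (e : ℕ)) ?_ v hv
      rw [Submodule.eq_top_iff']
      intro f
      obtain ⟨r, hrK, hf⟩ := hdig f f.2
      have hfe : f = ∑ e : Fin p,
          (⟨HahnSeries.single (1 : ℤ) (1 : ZMod p), hX⟩ : K₀) ^ (e : ℕ) * (⟨r e, hrK e⟩ : K₀) ^ p := by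
        apply Subtype.ext
        push_cast
        exact hf
      rw [hfe]
      refine Submodule.sum_mem _ fun e _ => ?_
      have hmem : (⟨r e, hrK e⟩ : K₀) ^ p ∈ (frobenius K₀ p).fieldRange :=
        RingHom.mem_fieldRange.mpr ⟨⟨r e, hrK e⟩, rfl⟩
      have hterm : (⟨HahnSeries.single (1 : ℤ) (1 : ZMod p), hX⟩ : K₀) ^ (e : ℕ) * (⟨r e, hrK e⟩ : K₀) ^ p =
          (⟨_, hmem⟩ : (frobenius K₀ p).fieldRange) •
            (⟨HahnSeries.single (1 : ℤ) (1 : ZMod p), hX⟩ : K₀) ^ (e : ℕ) := by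
        rw [Subfield.smul_def, smul_eq_mul, mul_comm]
      rw [hterm]
      exact Submodule.smul_mem _ _ (Submodule.subset_span ⟨e, rfl⟩)
    · -- (b) perfect subfields of `K₀ ≤ 𝔽_p((X))` are the prime field
      intro k₀ _ _ φ a
      refine ⟨(K₀.subtype (φ a)).coeff 0, Subtype.ext ?_⟩
      have h1 := Theorems.laurentSeries_ringHom_eq_C_of_perfectField p (K₀.subtype.comp φ) a
      rw [RingHom.comp_apply] at h1
      have h2 : ((algebraMap (ZMod p) K₀ ((K₀.subtype (φ a)).coeff 0) : K₀) : (ZMod p)⸨X⸩) =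
          HahnSeries.C ((K₀.subtype (φ a)).coeff 0) := by
        rw [show HahnSeries.C = algebraMap (ZMod p) ((ZMod p)⸨X⸩) from Subsingleton.elim _ _, ← hcomp]
        rfl
      rw [h2]
      exact h1

/-- Pointwise form for the LADDER wording: every prime has a countable residual field of `p`-rank one. -/
theorem existsResidualFieldOfPRankOne_of_prime (p : ℕ) (hp : p.Prime) : ExistsResidualFieldOfPRankOne p :=
  haveI : Fact p.Prime := ⟨hp⟩
  existsResidualFieldOfPRankOne p

end Summit.ResolutionOfSingularities.ResolutionOfSingularities.Cruxes.DescentPerfectToAll.NegationLimitDescent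

end
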